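import Mathlib
import HarnessLib
import Summits.CriticalPhenomena.PercolationContinuityZ3.Theses.PercTreeValue
import Summits.CriticalPhenomena.PercolationContinuityZ3.Theorems.PercTreeValueTetrahedronDisjointCoexistenceStubPairSymm
import Literature.Probability.Percolation.TwoPointFunction
import Literature.Probability.Percolation.TreeGraphBound
import Literature.Probability.Percolation.RSW
import Literature.Probability.Percolation.BondPercolationSymmetry
import Literature.Probability.LatticeModels.ThermodynamicLimit

/-!
# Line `Sketch` — skeleton for crux `TetrahedronDisjointCoexistence` (stmt-CriticalPhenomena-7798)

Lead: prover-line-stmt-CriticalPhenomena-7798-c3-0 (gen 1 continuation; REV C3 2026-08-16T22:10Z). Rev c3: every provable stub of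
rev c2 is LANDED (T1 `stub_tiledShell` p127055, T2 `stub_cruxOfTiledShell` p127243 = TransferD, L1 p127132 = LinkBoxOfCore,
L2 p127220 = LinkBoxPositivity), so the crux is kernel-reduced to S4 = X_B (stmt-CriticalPhenomena-0846) ∧ S5' `stub_boxRestriction`;
rev c3 ADDS the aspect side of S4: T1' `stub_tiledShellAspect` (tiles `v + B(s) ⊆ v + B(t)` of ANY aspect, provable now — the
T1 proof verbatim), S4' `stub_annulusNonCrossingFour` (X_B at aspect 4: OPEN, equivalent to X_B but numerically measurable,
`1 − P ≈ 1.7·10⁻³` flat in `n = 4…48`, Numerics-Sketch-c1) and the link X4 `stub_annulusNonCrossing_of_aspectFour` (S4' ⇒ S4,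
provable now: tiles `(m, 4m)`, `m = ⌊(n−2)/5⌋`, on the grid `(2m+1)·B(4)` for `n ≥ 7`, finite energy below), with the composition
`TetrahedronDisjointCoexistence_of_aspectFour`. Previous lead prover-line-stmt-CriticalPhenomena-7798-c2-0 (REV C2 2026-08-16T21:40Z). Rev c2 RESHAPES the composition:
the closed shell is no longer one aspect-2 cube annulus (which pinned `0, a_r` into a depth-1/8 corner pocket, S5) but a
TILED thin shell — a bounded grid (`≤ 51³` tiles) of translated aspect-2 X_B annuli glued by Harris–FKG for decreasing
events (`stub_tiledShell`, T1, provable now) — so the restriction stub relaxes to `stub_boxRestriction` (S5', OPEN, lead):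
`P(0 ↔ a_r inside Box_r = [−r,2r]² × [−2r,3k]) ≥ c τ(0,a_r)`, endpoints `3k ≈ 3r/8` below the roof and `≥ r` from the other
faces; S5 ⇒ S5' (`stub_boxRestriction_of_coreRestriction`, L1) and S5' ⇒ S12 (`stub_restrictionPositivity_of_boxRestriction`,
L2); transfer `stub_cruxOfTiledShell` (T2). `TetrahedronDisjointCoexistence_of` below is the rev-c2 composition (uses S1, S3,
S4, S5', T1 only). History: c1 lead prover-line-stmt-CriticalPhenomena-7798-c1-0 (rev 1 registered S1–S7; rev 3 added S8–S9;
rev 4 S10). REGISTRY FILE: every `stub_*` stays `sorry` here so that `ledger skeleton check` keeps the full stub list; the wired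
version with the LANDED proofs imported is `work/TetrahedronDisjointCoexistenceAssembled.lean` in the lead's folder.
LANDED (c1): S1 p120307, S2 p120159, S3 p120083, S6 p120474 (TransferC), S7 p120328, S8 p120771, S9 p120948, S10 p125940. Built on the planners'
`Cruxes/TetrahedronDisjointCoexistence/SketchIdeator1.lean` (ideator 1), card 2 `closed-shell-barrier-dichotomy`
(composition `CardTwoAssembly : ShellDecoupling → ShellFromBarrier → Barrier 30 → SlabRestrictionCore →
SlabRestrictionHalf → TDC`), RESHAPED so that the closed shell is supplied by the sibling crux
`PercAnnulusCrossing.CritAnnulusNonCrossing` (stmt-CriticalPhenomena-0846, "X_B": at `p_c`, with probability `≥ c`,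
no open path inside `B(2n)` joins `B(n)` to `∂B(2n)`) instead of the card's stronger `Barrier 30` + Kesten walls, and
so that ONE restriction stub serves both pairs (the second by the rotoreflection `φ_r` of `T_r`). Card 1 of the same
sketch (`CeilingDecoupling → CeilingMirror → HalfHeightConfinement`) is composition A of line `SketchIdeator2`, all
of whose provable content is landed (`stub_confineProduct`, `stub_pairSymm`, `stub_cruxOfConfinement`); it is not
repeated here. Every `stub_*` is DEF-FREE over tree declarations.

Route `PercTreeValue`, crux (rank 2):
`TetrahedronDisjointCoexistence : ∃ δ > 0, ∃ r₀, ∀ r ≥ r₀, δ · τ(0,a_r) · τ(b_r,c_r) ≤ P_{p_c}(0 ↔ a_r, b_r ↔ c_r, 0 ↮ b_r)`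
with `a_r = (r,r,0)`, `b_r = (r,0,r)`, `c_r = (0,r,r)`, `P = bondPercolation (zdGraph 3) (criticalProbI 3)`.

OBJECTS (prose only; the stubs spell them out). `k := r / 8`, `K := k + 1`, `v_r := (4K, 4K, −4K)`, `n_r := 5K`:
* `Core_r := [−k, r+k]² × [−(r+k), k]` (a cube of side `r + 2k` with `0`, `a_r` at depth `k` below its roof and
  `k` from two of its sides) ⊆ `v_r + B(n_r − 1)`;
* `Outer_r := v_r + B(2 n_r)` (top face at height `6K`), `W_r := {x | 6K + 1 ≤ x₂}` ∋ `b_r, c_r` (`r ≥ 56`);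
* `Shell(R, R') := {no open path of R' ∖ R from a vertex adjacent to R to a vertex adjacent to R'ᶜ}` — a
  DECREASING event on the pairs inside `R' ∖ R`;
* `φ_r(x) := (r − x₁, x₀, r − x₂)` (`0 ↦ b_r`, `a_r ↦ c_r`; `φ_r {h ≤ x₂} = {x₂ ≤ r − h}`).

THE LINE (closed-shell decoupling; composition path = S1 + S2 + S3 + S4 + S5 + landed `stub_pairSymm`):
  `P(0 ↔_{Core} a_r) · P(Shell(Core, Outer)) · P(b_r ↔_{W} c_r) ≤ P(target)`            (S1, every `p`, every graph)
  `Shell(Core, Outer) ⊇ (v_r + X_B-event(n_r))ᶜ`, `P(v_r + X_B(n)) = P(X_B(n)) ≤ 1 − c_X`   (glue, S2, S4 = X_B OPEN)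
  `P(b_r ↔_{W_r} c_r) = P(0 ↔_{φ W_r} a_r) ≥ P(0 ↔_{Core_r} a_r) ≥ c · τ(0,a_r)`            (S3, monotonicity, S5 OPEN)
  `τ(b_r, c_r) = τ(0, a_r)` (landed `stub_pairSymm`)  ⟹  crux with `δ = c_X · c²`, `r₀ ↦ max r₀ 56`.
* `stub_shellDecoupling` (S1, provable now, M): three events on the pairwise disjoint pair sets `R.sym2`,
  `(R'∖R).sym2`, `W.sym2` are independent (`bondPercolation_real_inter_of_disjoint` twice); on their intersection an
  open path `x₁ → x₂` would leave `R` through a vertex adjacent to `R` and reach a vertex adjacent to `R'ᶜ` inside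
  `R' ∖ R` (last exit from `R`, first exit from `R'`; lattice configurations `ω ⊆ E(ℤ³)` a.s., `ae_subset_edgeSet`).
* `stub_shiftBoxCrossing` (S2, provable now, S): translation invariance `bondPercolation_real_preimage_shift` for
  the X_B event (`mem_box`, `mem_innerBoundary_iff`, `zdGraph_adj_shift_iff`).
* `stub_mirrorRestrict` (S3, provable now, S): `φ_r` transports `{b_r ↔ c_r in {h ≤ x₂}}` to `{0 ↔ a_r in {x₂ ≤ r−h}}`
  (verbatim the proof of the landed `stub_restrictSymm`, roof height now a parameter).
* `stub_annulusNonCrossing` (S4, OPEN = stmt-CriticalPhenomena-0846 verbatim, crux of route `PercAnnulusCrossing`;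
  3-D RSW upper bound; continuity-strength on its own).
* `stub_coreRestriction` (S5, OPEN, lead): `P(0 ↔ a_r inside Core_r) ≥ c τ(0, a_r)` — van den Berg–Don's restriction
  question (arXiv:1912.10964, constant form) at relative depth `1/8`.
* `stub_cruxOfShellRestriction` (S6 = the composition as a transfer stub, provable once S1–S3 land).
X_B SIDE (provable now, off-path): `stub_annulusCrossing_le_walls` (S10: the X_B event is bounded by the six wall crossings of
`B(2n) ∖ B(n)` — S7 specialised + last exit from `B(n)`; the last step of the sibling support `PercAnnulusCrossing.BlockerRSWGlue`).
LINKS (provable now): `stub_restrictionPositivity_of_coreRestriction` (S8: S5 ⇒ S12 of `SketchIdeator2`),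
`stub_interfaceBlocking_of_shellRestriction` (S9: S4 ∧ S5 ⇒ S13 of `SketchIdeator2`) — the open pair of this line is sufficient
for the open pair of composition B there.
OFF-PATH (provable now; the card's own horn): `stub_shellOfSixWalls` (S7): Kesten's decomposition of a box annulus
into six wall slabs — no thin-direction open crossing of any wall ⇒ `Shell`, and Harris–FKG for the six decreasing
events gives `P(Shell) ≥ ∏ (1 − P(wall crossed))`; this is how `Barrier(M)` (card) or `CubeBlockingSeed`-type bounds
feed X_B-type shells (cf. `PercAnnulusCrossing.BlockerRSWGlue`).

Disproof.lean: none exists for this crux (2026-08-16T18:10Z, `ledger crux ls`).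
Obstructions honoured: S1–S3, S7 hold at EVERY `p` (S1, S7-pointwise on every graph), so all content sits in S4 ∧ S5;
S4 is false in every jump world (θ > 0 ⇒ `P(B(n) ↔ ∂B(2n)) → 1`, `crossingTendstoOne_proof`) as the crux must be;
S4 is false for `d > 6` (Aizenman 1997) although the crux holds there — the line is intrinsically low-dimensional.
-/

noncomputable section

open MeasureTheory Filter
open Literature.Probability.Percolation Literature.Probability.LatticeModels

namespace Summit.CriticalPhenomena.PercolationContinuityZ3.Cruxes.TetrahedronDisjointCoexistence.LineSketch

/-! ## S1 — closed-shell decoupling (the card's FIRST LEMMA, general graph) -/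

/-- S1 (provable now). For vertex sets `R ⊆ R'` with every neighbour of `R` inside `R'`, and `W` disjoint from
`R'`: `P(x₁ ↔ y₁ in R) · P(Shell(R,R')) · P(x₂ ↔ y₂ in W) ≤ P(x₁ ↔ y₁, x₂ ↔ y₂, x₁ ↮ x₂)`, where
`Shell(R,R')` = no open path of `R' ∖ R` from a vertex adjacent to `R` to a vertex adjacent to `R'ᶜ`. -/
theorem stub_shellDecoupling {V : Type*} [Countable V] (G : SimpleGraph V) (p : unitInterval)
    {R R' W : Set V} (hRR' : R ⊆ R') (hN : ∀ x ∈ R, ∀ y, G.Adj x y → y ∈ R') (hW : Disjoint R' W)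
    (x₁ y₁ x₂ y₂ : V) :
    (bondPercolation G p).real (openConnIn R x₁ y₁) *
          (bondPercolation G p).real
            {ω | ∀ u ∈ R' \ R, ∀ w ∈ R' \ R, (∃ z ∈ R, G.Adj u z) → (∃ z ∉ R', G.Adj w z) →
              ω ∉ openConnIn (R' \ R) u w} *
        (bondPercolation G p).real (openConnIn W x₂ y₂) ≤
      (bondPercolation G p).real (openConn x₁ y₁ ∩ openConn x₂ y₂ ∩ (openConn x₁ x₂)ᶜ) := by
  sorry

/-! ## S2 — translation of the X_B event -/

/-- S2 (provable now). Translation invariance of `P_p` on `ℤ³` for the annulus-crossing event of X_B: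
the event "some vertex of `v + B(n)` is joined inside `v + B(2n)` to a vertex of `v + B(2n)` adjacent to its
complement" has the probability of the centred event of `PercAnnulusCrossing.CritAnnulusNonCrossing`. -/
theorem stub_shiftBoxCrossing (p : unitInterval) (v : Site 3) (n : ℕ) :
    (bondPercolation (zdGraph 3) p).real
        {ω | ∃ x : Site 3, x - v ∈ box 3 n ∧ ∃ y : Site 3, y - v ∈ box 3 (2 * n) ∧
          (∃ z : Site 3, z - v ∉ box 3 (2 * n) ∧ (zdGraph 3).Adj y z) ∧
          ω ∈ openConnIn {u : Site 3 | u - v ∈ box 3 (2 * n)} x y} =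
      (bondPercolation (zdGraph 3) p).real
        {ω | ∃ x ∈ box 3 n, ∃ y ∈ innerBoundary (zdGraph 3) (box 3 (2 * n)),
          ω ∈ openConnIn ↑(box 3 (2 * n)) x y} := by
  sorry

/-! ## S3 — the rotoreflection `φ_r` for restricted connections, roof height as a parameter -/

/-- S3 (provable now). `φ_r(x) = (r − x₁, x₀, r − x₂)` is an automorphism of `zdGraph 3` with `φ_r 0 = b_r`,
`φ_r a_r = c_r`, `φ_r {x | h ≤ x₂} = {x | x₂ ≤ r − h}`; hence `P(b_r ↔ c_r in {h ≤ x₂}) = P(0 ↔ a_r in {x₂ ≤ r − h})`. -/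
theorem stub_mirrorRestrict (p : unitInterval) (r : ℕ) (h : ℤ) :
    (bondPercolation (zdGraph 3) p).real
        (openConnIn {x : Site 3 | h ≤ x 2} (![(r : ℤ), 0, (r : ℤ)] : Site 3) ![0, (r : ℤ), (r : ℤ)]) =
      (bondPercolation (zdGraph 3) p).real
        (openConnIn {x : Site 3 | x 2 ≤ (r : ℤ) - h} (0 : Site 3) ![(r : ℤ), (r : ℤ), 0]) := by
  sorry

/-! ## S4 — X_B (OPEN; = stmt-CriticalPhenomena-0846 `PercAnnulusCrossing.CritAnnulusNonCrossing`, verbatim) -/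

/-- S4 (OPEN — crux of the sibling route `PercAnnulusCrossing`, stmt-CriticalPhenomena-0846, stated verbatim):
at `p_c(ℤ³)`, uniformly in `n ≥ 1`, with probability `≥ c` no open path inside `B(2n)` joins `B(n)` to the inner
vertex boundary of `B(2n)` (a closed dual plaquette surface separates them). 3-D analogue of the RSW upper bound. -/
theorem stub_annulusNonCrossing :
    ∃ c : ℝ, 0 < c ∧ ∀ n : ℕ, 1 ≤ n →
      (bondPercolation (zdGraph 3) (criticalProbI 3)).real
          {ω | ∃ x ∈ box 3 n, ∃ y ∈ innerBoundary (zdGraph 3) (box 3 (2 * n)),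
            ω ∈ openConnIn ↑(box 3 (2 * n)) x y} ≤ 1 - c := by
  sorry

/-! ## S5 — core restriction at relative depth 1/8 (OPEN, lead) -/

/-- S5 (OPEN — the transfer; van den Berg–Don's restriction question in constant form at relative depth `1/8`):
with `k = ⌊r/8⌋`, connecting `0` to `a_r = (r,r,0)` INSIDE the cube `Core_r = [−k, r+k]² × [−(r+k), k]` costs
at most a constant factor against the unrestricted two-point function, uniformly in `r`. -/
theorem stub_coreRestriction :
    ∃ c : ℝ, 0 < c ∧ ∃ r₀ : ℕ, ∀ r : ℕ, r₀ ≤ r →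
      c * tau 3 (criticalProbI 3) 0 ![(r : ℤ), (r : ℤ), 0] ≤
        (bondPercolation (zdGraph 3) (criticalProbI 3)).real
          (openConnIn
            {x : Site 3 | -((r : ℤ) / 8) ≤ x 0 ∧ x 0 ≤ (r : ℤ) + (r : ℤ) / 8 ∧
              -((r : ℤ) / 8) ≤ x 1 ∧ x 1 ≤ (r : ℤ) + (r : ℤ) / 8 ∧
              -((r : ℤ) + (r : ℤ) / 8) ≤ x 2 ∧ x 2 ≤ (r : ℤ) / 8}
            (0 : Site 3) ![(r : ℤ), (r : ℤ), 0]) := by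
  sorry


/-! ## S5' — box restriction at relative depth 3/8 below the roof, margins ≥ r elsewhere (OPEN, lead; rev c2) -/

/-- S5' (OPEN — rev c2 residue; WEAKER than S5 since `Core_r ⊆ Box_r`): with `k = ⌊r/8⌋`, connecting `0` to
`a_r = (r,r,0)` INSIDE the box `Box_r = [−r, 2r]² × [−2r, 3k]` — both endpoints `3k ≈ 3r/8` below the roof and at
distance `≥ r` from the five other faces — costs at most a constant factor against the unrestricted two-point function,
uniformly in `r`. Van den Berg–Don's restriction question (arXiv:1912.10964) in its mildest box form; the thin tiled
shell (`stub_tiledShell`) is what makes a roof depth this close to `r/2` admissible. MC (c2, kit j020012/15/16/18). -/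
theorem stub_boxRestriction :
    ∃ c : ℝ, 0 < c ∧ ∃ r₀ : ℕ, ∀ r : ℕ, r₀ ≤ r →
      c * tau 3 (criticalProbI 3) 0 ![(r : ℤ), (r : ℤ), 0] ≤
        (bondPercolation (zdGraph 3) (criticalProbI 3)).real
          (openConnIn
            {x : Site 3 | -(r : ℤ) ≤ x 0 ∧ x 0 ≤ 2 * (r : ℤ) ∧ -(r : ℤ) ≤ x 1 ∧ x 1 ≤ 2 * (r : ℤ) ∧
              -(2 * (r : ℤ)) ≤ x 2 ∧ x 2 ≤ 3 * ((r : ℤ) / 8)}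
            (0 : Site 3) ![(r : ℤ), (r : ℤ), 0]) := by
  sorry

/-! ## T1 — the tiled shell: Harris–FKG gluing of a bounded grid of translated aspect-2 X_B annuli (provable now; rev c2) -/

/-- T1 (provable now, M). **Tiled closed shell.** Fix `p`, a tile radius `s` and `c ≥ 0` with
`P_p(X_B event at scale s) ≤ 1 − c` (the event of `PercAnnulusCrossing.CritAnnulusNonCrossing` at `n = s`). Let `R, R'` be
vertex sets and `J` a finite set of tile centres such that every vertex `u ∈ R' ∖ R` adjacent to `R` lies in a tile
`v + B(s)`, `v ∈ J`, whose doubled tile has room: every lattice neighbour of `v + B(2s)` lies in `R'`. Then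
`c ^ |J| ≤ P_p(Shell(R, R'))`, `Shell(R,R')` = no open path of `R' ∖ R` from a vertex adjacent to `R` to a vertex adjacent
to `R'ᶜ`. Proof: on lattice configurations, such a path starts in some `v + B(s)` and must leave `v + B(2s)` (its endpoint
has a neighbour outside `R'`), so up to its first exit (`exists_openConnIn_le_level` for the sup-distance to `v`) it realises
the `v`-translate of the X_B event; hence `⋂_{v ∈ J} (translated X_B event)ᶜ ⊆ Shell` a.e.; the translated events are
increasing and measurable with probability `P(X_B) ≤ 1 − c` (`stub_shiftBoxCrossing`, landed), and Harris–FKG for the `|J|`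
decreasing complements (`sixWalls_prod_real_le_biInter`, landed) gives `∏ (1 − P) ≥ c^|J|`. This is also the aspect-ratio
equivalence behind X_B (aspect 2 ⇔ any bounded shell geometry, constants `c ↦ c^N`). -/
theorem stub_tiledShell (p : unitInterval) (s : ℕ) (c : ℝ) (hc : 0 ≤ c)
    (hXB : (bondPercolation (zdGraph 3) p).real
        {ω | ∃ x ∈ box 3 s, ∃ y ∈ innerBoundary (zdGraph 3) (box 3 (2 * s)),
          ω ∈ openConnIn ↑(box 3 (2 * s)) x y} ≤ 1 - c)
    (R R' : Set (Site 3)) (J : Finset (Site 3))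
    (hcover : ∀ u ∈ R' \ R, (∃ z ∈ R, (zdGraph 3).Adj u z) →
      ∃ v ∈ J, u - v ∈ box 3 s ∧
        ∀ y : Site 3, y - v ∈ box 3 (2 * s) → ∀ z : Site 3, (zdGraph 3).Adj y z → z ∈ R') :
    c ^ J.card ≤ (bondPercolation (zdGraph 3) p).real
        {ω | ∀ u ∈ R' \ R, ∀ w ∈ R' \ R, (∃ z ∈ R, (zdGraph 3).Adj u z) → (∃ z ∉ R', (zdGraph 3).Adj w z) →
          ω ∉ openConnIn (R' \ R) u w} := by
  sorry

/-! ## T2 — the rev-c2 composition as a registered transfer stub (provable once T1 lands) -/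

/-- T2 (transfer, rev c2): X_B together with BOX restriction (S5') gives the crux, with `δ = c_X ^ (51³) · c²`
(`51³` tiles of radius `s = ⌊k/2⌋ − 1` on a grid of mesh `2s+1` around `Box_r ⊆ Box_r + B(2k−1)`, `W = {r − 3k ≤ x₂}`,
`r ≥ 64`) — concluded as the crux's statement VERBATIM (unfolded), cf. `TetrahedronDisjointCoexistence_of` below. -/
theorem stub_cruxOfTiledShell
    (hXB : ∃ c : ℝ, 0 < c ∧ ∀ n : ℕ, 1 ≤ n →
      (bondPercolation (zdGraph 3) (criticalProbI 3)).real
          {ω | ∃ x ∈ box 3 n, ∃ y ∈ innerBoundary (zdGraph 3) (box 3 (2 * n)),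
            ω ∈ openConnIn ↑(box 3 (2 * n)) x y} ≤ 1 - c)
    (hBox : ∃ c : ℝ, 0 < c ∧ ∃ r₀ : ℕ, ∀ r : ℕ, r₀ ≤ r →
      c * tau 3 (criticalProbI 3) 0 ![(r : ℤ), (r : ℤ), 0] ≤
        (bondPercolation (zdGraph 3) (criticalProbI 3)).real
          (openConnIn
            {x : Site 3 | -(r : ℤ) ≤ x 0 ∧ x 0 ≤ 2 * (r : ℤ) ∧ -(r : ℤ) ≤ x 1 ∧ x 1 ≤ 2 * (r : ℤ) ∧
              -(2 * (r : ℤ)) ≤ x 2 ∧ x 2 ≤ 3 * ((r : ℤ) / 8)}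
            (0 : Site 3) ![(r : ℤ), (r : ℤ), 0])) :
    ∃ δ : ℝ, 0 < δ ∧ ∃ r₀ : ℕ, ∀ r : ℕ, r₀ ≤ r →
      δ * tau 3 (criticalProbI 3) 0 ![(r : ℤ), (r : ℤ), 0] *
          tau 3 (criticalProbI 3) ![(r : ℤ), 0, (r : ℤ)] ![0, (r : ℤ), (r : ℤ)] ≤
        (bondPercolation (zdGraph 3) (criticalProbI 3)).real
          (openConn 0 ![(r : ℤ), (r : ℤ), 0] ∩ openConn ![(r : ℤ), 0, (r : ℤ)] ![0, (r : ℤ), (r : ℤ)] ∩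
            (openConn (0 : Site 3) ![(r : ℤ), 0, (r : ℤ)])ᶜ) := by
  sorry

/-! ## T1' — the tiled shell with tiles of arbitrary aspect (provable now; rev c3) -/

/-- T1' (provable now, M; rev c3). **Tiled closed shell, tiles of any aspect.** The landed T1 with the outer tile
radius freed: fix `p`, radii `s ≤ t` and `c ≥ 0` with `P_p(A(s,t)) ≤ 1 − c`, `A(s,t)` = "some vertex of `B(s)` is
joined inside `B(t)` to a vertex of `∂ⁱⁿB(t)`" (`t = 2s`: X_B; `t = 4s`: its aspect-4 form). If every vertex
`u ∈ R' ∖ R` adjacent to `R` lies in a tile `v + B(s)`, `v ∈ J`, all of whose `v + B(t)`-neighbours lie in `R'`, then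
`c ^ |J| ≤ P_p(Shell(R, R'))`. Proof: T1's, with `box 3 t` for `box 3 (2 * s)`. -/
theorem stub_tiledShellAspect (p : unitInterval) {s t : ℕ} (hst : s ≤ t) (c : ℝ) (hc : 0 ≤ c)
    (hXB : (bondPercolation (zdGraph 3) p).real
        {ω | ∃ x ∈ box 3 s, ∃ y ∈ innerBoundary (zdGraph 3) (box 3 t),
          ω ∈ openConnIn ↑(box 3 t) x y} ≤ 1 - c)
    (R R' : Set (Site 3)) (J : Finset (Site 3))
    (hcover : ∀ u ∈ R' \ R, (∃ z ∈ R, (zdGraph 3).Adj u z) →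
      ∃ v ∈ J, u - v ∈ box 3 s ∧
        ∀ y : Site 3, y - v ∈ box 3 t → ∀ z : Site 3, (zdGraph 3).Adj y z → z ∈ R') :
    c ^ J.card ≤ (bondPercolation (zdGraph 3) p).real
        {ω | ∀ u ∈ R' \ R, ∀ w ∈ R' \ R, (∃ z ∈ R, (zdGraph 3).Adj u z) → (∃ z ∉ R', (zdGraph 3).Adj w z) →
          ω ∉ openConnIn (R' \ R) u w} := by
  sorry

/-! ## S4' — X_B at aspect 4 (OPEN; equivalent to S4, numerically measurable; rev c3) -/

/-- S4' (OPEN — rev c3; the aspect-4 form of the sibling crux X_B = stmt-CriticalPhenomena-0846): at `p_c(ℤ³)`, uniformly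
in `n ≥ 1`, with probability `≥ c` no open path inside `B(4n)` joins `B(n)` to the inner vertex boundary of `B(4n)`.
WEAKER than S4 pointwise (a crossing of `B(4n) ∖ B(n)` crosses `B(2n) ∖ B(n)`), EQUIVALENT to it by X4 below; unlike S4
(`1 − P < 1.3·10⁻⁴` at aspect 2, 0 non-crossings in 23 300 samples) it is numerically visible: `1 − P ≈ 1.7·10⁻³`, flat
in `n = 4…48` (Numerics-Sketch-c1.md). Continuity-strength exactly like S4 (`crossingTendstoOne_proof`). -/
theorem stub_annulusNonCrossingFour :
    ∃ c : ℝ, 0 < c ∧ ∀ n : ℕ, 1 ≤ n →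
      (bondPercolation (zdGraph 3) (criticalProbI 3)).real
          {ω | ∃ x ∈ box 3 n, ∃ y ∈ innerBoundary (zdGraph 3) (box 3 (4 * n)),
            ω ∈ openConnIn ↑(box 3 (4 * n)) x y} ≤ 1 - c := by
  sorry

/-! ## X4 — aspect reduction for X_B (provable now; rev c3): S4' ⇒ S4 -/

/-- X4 (provable now, M; rev c3). **The aspect ratio of X_B is immaterial**: the aspect-4 annulus bound implies
`PercAnnulusCrossing.CritAnnulusNonCrossing` verbatim (aspect 2). For `n ≥ 7` put `m = ⌊(n−2)/5⌋ ≥ 1`; an X_B crossing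
of `B(2n) ∖ B(n)` yields (last exit from `B(n)`, landed `annulusWalls_crossing`) a shell crossing from a neighbour `u` of
`B(n)` to a vertex adjacent to `B(2n)ᶜ`; `u` lies in the tile `v + B(m)` of the grid `v ∈ (2m+1)·B(4)` and every neighbour
of `v + B(4m)` lies in `B(2n)` (`n + 5m + 2 ≤ 2n`), so T1' gives `P(X_B(n)) ≤ 1 − c₄^(9³)`; for `1 ≤ n ≤ 6` finite energy
(`P(no crossing) ≥ (1 − p_c)^{#edges touching B(n)} > 0`, `p_c < 1`). -/
theorem stub_annulusNonCrossing_of_aspectFour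
    (h4 : ∃ c : ℝ, 0 < c ∧ ∀ n : ℕ, 1 ≤ n →
      (bondPercolation (zdGraph 3) (criticalProbI 3)).real
          {ω | ∃ x ∈ box 3 n, ∃ y ∈ innerBoundary (zdGraph 3) (box 3 (4 * n)),
            ω ∈ openConnIn ↑(box 3 (4 * n)) x y} ≤ 1 - c) :
    ∃ c : ℝ, 0 < c ∧ ∀ n : ℕ, 1 ≤ n →
      (bondPercolation (zdGraph 3) (criticalProbI 3)).real
          {ω | ∃ x ∈ box 3 n, ∃ y ∈ innerBoundary (zdGraph 3) (box 3 (2 * n)),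
            ω ∈ openConnIn ↑(box 3 (2 * n)) x y} ≤ 1 - c := by
  sorry

/-- The rev-c3 composition variant: the crux BY NAME from X_B AT ASPECT 4 (S4') and box restriction (S5'), through
X4 and the transfer T2. -/
theorem TetrahedronDisjointCoexistence_of_aspectFour :
    Theses.PercTreeValue.TetrahedronDisjointCoexistence := by
  unfold Theses.PercTreeValue.TetrahedronDisjointCoexistence
  exact stub_cruxOfTiledShell (stub_annulusNonCrossing_of_aspectFour stub_annulusNonCrossingFour)
    stub_boxRestriction

/-! ## L1–L2 — links (provable now, rev c2): S5 ⇒ S5' ⇒ S12 -/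

/-- L1 (provable now, trivial monotonicity): core restriction (S5) implies box restriction (S5'), since
`Core_r = [−k, r+k]² × [−(r+k), k] ⊆ Box_r = [−r, 2r]² × [−2r, 3k]` (`openConnIn_mono`). The rev-c2 residue is weaker. -/
theorem stub_boxRestriction_of_coreRestriction
    (hCore : ∃ c : ℝ, 0 < c ∧ ∃ r₀ : ℕ, ∀ r : ℕ, r₀ ≤ r →
      c * tau 3 (criticalProbI 3) 0 ![(r : ℤ), (r : ℤ), 0] ≤
        (bondPercolation (zdGraph 3) (criticalProbI 3)).real
          (openConnIn
            {x : Site 3 | -((r : ℤ) / 8) ≤ x 0 ∧ x 0 ≤ (r : ℤ) + (r : ℤ) / 8 ∧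
              -((r : ℤ) / 8) ≤ x 1 ∧ x 1 ≤ (r : ℤ) + (r : ℤ) / 8 ∧
              -((r : ℤ) + (r : ℤ) / 8) ≤ x 2 ∧ x 2 ≤ (r : ℤ) / 8}
            (0 : Site 3) ![(r : ℤ), (r : ℤ), 0])) :
    ∃ c : ℝ, 0 < c ∧ ∃ r₀ : ℕ, ∀ r : ℕ, r₀ ≤ r →
      c * tau 3 (criticalProbI 3) 0 ![(r : ℤ), (r : ℤ), 0] ≤
        (bondPercolation (zdGraph 3) (criticalProbI 3)).real
          (openConnIn
            {x : Site 3 | -(r : ℤ) ≤ x 0 ∧ x 0 ≤ 2 * (r : ℤ) ∧ -(r : ℤ) ≤ x 1 ∧ x 1 ≤ 2 * (r : ℤ) ∧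
              -(2 * (r : ℤ)) ≤ x 2 ∧ x 2 ≤ 3 * ((r : ℤ) / 8)}
            (0 : Site 3) ![(r : ℤ), (r : ℤ), 0]) := by
  sorry

/-- L2 (provable now, trivial monotonicity): box restriction (S5') implies the half-space RESTRICTION POSITIVITY
`stub_restrictionPositivity` (S12 of line `SketchIdeator2`, verbatim conclusion), since `Box_r ⊆ H_r = {2x₂ + 2 ≤ r}` for
`r ≥ 8` (`3⌊r/8⌋ ≤ (r − 2)/2`). -/
theorem stub_restrictionPositivity_of_boxRestriction
    (hBox : ∃ c : ℝ, 0 < c ∧ ∃ r₀ : ℕ, ∀ r : ℕ, r₀ ≤ r →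
      c * tau 3 (criticalProbI 3) 0 ![(r : ℤ), (r : ℤ), 0] ≤
        (bondPercolation (zdGraph 3) (criticalProbI 3)).real
          (openConnIn
            {x : Site 3 | -(r : ℤ) ≤ x 0 ∧ x 0 ≤ 2 * (r : ℤ) ∧ -(r : ℤ) ≤ x 1 ∧ x 1 ≤ 2 * (r : ℤ) ∧
              -(2 * (r : ℤ)) ≤ x 2 ∧ x 2 ≤ 3 * ((r : ℤ) / 8)}
            (0 : Site 3) ![(r : ℤ), (r : ℤ), 0])) :
    ∃ c₁ : ℝ, 0 < c₁ ∧ ∃ r₀ : ℕ, ∀ r : ℕ, r₀ ≤ r →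
      c₁ * tau 3 (criticalProbI 3) 0 ![(r : ℤ), (r : ℤ), 0] ≤
        (bondPercolation (zdGraph 3) (criticalProbI 3)).real
          (openConnIn {x : Site 3 | 2 * x 2 + 2 ≤ (r : ℤ)} (0 : Site 3) ![(r : ℤ), (r : ℤ), 0]) := by
  sorry


/-! ## S6 — the composition as a registered transfer stub (provable once S1–S3 land) -/

/-- S6 (transfer): X_B together with core restriction gives the crux with `δ = c_X · c²` — concluded as the crux's
statement VERBATIM (unfolded), so that the skeleton audit sees a single theorem concluding the crux by name
(`TetrahedronDisjointCoexistence_of` below); `unfold Theses.PercTreeValue.TetrahedronDisjointCoexistence; exact …`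
recovers the named form. -/
theorem stub_cruxOfShellRestriction
    (hXB : ∃ c : ℝ, 0 < c ∧ ∀ n : ℕ, 1 ≤ n →
      (bondPercolation (zdGraph 3) (criticalProbI 3)).real
          {ω | ∃ x ∈ box 3 n, ∃ y ∈ innerBoundary (zdGraph 3) (box 3 (2 * n)),
            ω ∈ openConnIn ↑(box 3 (2 * n)) x y} ≤ 1 - c)
    (hCore : ∃ c : ℝ, 0 < c ∧ ∃ r₀ : ℕ, ∀ r : ℕ, r₀ ≤ r →
      c * tau 3 (criticalProbI 3) 0 ![(r : ℤ), (r : ℤ), 0] ≤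
        (bondPercolation (zdGraph 3) (criticalProbI 3)).real
          (openConnIn
            {x : Site 3 | -((r : ℤ) / 8) ≤ x 0 ∧ x 0 ≤ (r : ℤ) + (r : ℤ) / 8 ∧
              -((r : ℤ) / 8) ≤ x 1 ∧ x 1 ≤ (r : ℤ) + (r : ℤ) / 8 ∧
              -((r : ℤ) + (r : ℤ) / 8) ≤ x 2 ∧ x 2 ≤ (r : ℤ) / 8}
            (0 : Site 3) ![(r : ℤ), (r : ℤ), 0])) :
    ∃ δ : ℝ, 0 < δ ∧ ∃ r₀ : ℕ, ∀ r : ℕ, r₀ ≤ r →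
      δ * tau 3 (criticalProbI 3) 0 ![(r : ℤ), (r : ℤ), 0] *
          tau 3 (criticalProbI 3) ![(r : ℤ), 0, (r : ℤ)] ![0, (r : ℤ), (r : ℤ)] ≤
        (bondPercolation (zdGraph 3) (criticalProbI 3)).real
          (openConn 0 ![(r : ℤ), (r : ℤ), 0] ∩ openConn ![(r : ℤ), 0, (r : ℤ)] ![0, (r : ℤ), (r : ℤ)] ∩
            (openConn (0 : Site 3) ![(r : ℤ), 0, (r : ℤ)])ᶜ) := by
  sorry

/-! ## S7 — off-path: Kesten's six walls (the card's horn; provable now) -/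

/-- S7 (provable now, off-path). For boxes `R = Icc lo hi ⊆ R' = Icc lo' hi'` of `ℤ³` with `lo' < lo`, `hi < hi'`
coordinatewise: if none of the six wall slabs of `R' ∖ R` (e.g. the top wall `{z ∈ R' | hi₂ + 1 ≤ z₂}`) has an open
crossing in its thin direction, then `Shell(R, R')` holds (an open path of `R' ∖ R` from a neighbour of `R` to a
vertex adjacent to `R'ᶜ` crosses, after its last visit to the near face, the wall of the face through which it
leaves); the six non-crossing events are decreasing, so Harris–FKG bounds `P(Shell)` below by the product. -/
theorem stub_shellOfSixWalls (p : unitInterval) (lo hi lo' hi' : Site 3) (hlo : ∀ i, lo' i < lo i)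
    (hhi : ∀ i, hi i < hi' i) :
    (∏ i : Fin 3,
        ((1 - (bondPercolation (zdGraph 3) p).real
            {ω | ∃ x y : Site 3, x ∈ Set.Icc lo' hi' ∧ y ∈ Set.Icc lo' hi' ∧ x i = hi i + 1 ∧ y i = hi' i ∧
              ω ∈ openConnIn (Set.Icc lo' hi' ∩ {z | hi i + 1 ≤ z i}) x y}) *
          (1 - (bondPercolation (zdGraph 3) p).real
            {ω | ∃ x y : Site 3, x ∈ Set.Icc lo' hi' ∧ y ∈ Set.Icc lo' hi' ∧ x i = lo i - 1 ∧ y i = lo' i ∧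
              ω ∈ openConnIn (Set.Icc lo' hi' ∩ {z | z i ≤ lo i - 1}) x y}))) ≤
      (bondPercolation (zdGraph 3) p).real
        {ω | ∀ u ∈ Set.Icc lo' hi' \ Set.Icc lo hi, ∀ w ∈ Set.Icc lo' hi' \ Set.Icc lo hi,
          (∃ z ∈ Set.Icc lo hi, (zdGraph 3).Adj u z) → (∃ z ∉ Set.Icc lo' hi', (zdGraph 3).Adj w z) →
          ω ∉ openConnIn (Set.Icc lo' hi' \ Set.Icc lo hi) u w} := by
  sorry

/-! ## S8–S9 — links to line `SketchIdeator2` (provable now): (S5 ⇒ S12) and (S4 ∧ S5 ⇒ S13) -/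

/-- S8 (provable now, trivial monotonicity): core restriction implies the half-space RESTRICTION POSITIVITY
`stub_restrictionPositivity` (S12 of line `SketchIdeator2`, verbatim conclusion), since `Core_r ⊆ H_r = {2x₂ + 2 ≤ r}`. -/
theorem stub_restrictionPositivity_of_coreRestriction
    (hCore : ∃ c : ℝ, 0 < c ∧ ∃ r₀ : ℕ, ∀ r : ℕ, r₀ ≤ r →
      c * tau 3 (criticalProbI 3) 0 ![(r : ℤ), (r : ℤ), 0] ≤
        (bondPercolation (zdGraph 3) (criticalProbI 3)).real
          (openConnIn
            {x : Site 3 | -((r : ℤ) / 8) ≤ x 0 ∧ x 0 ≤ (r : ℤ) + (r : ℤ) / 8 ∧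
              -((r : ℤ) / 8) ≤ x 1 ∧ x 1 ≤ (r : ℤ) + (r : ℤ) / 8 ∧
              -((r : ℤ) + (r : ℤ) / 8) ≤ x 2 ∧ x 2 ≤ (r : ℤ) / 8}
            (0 : Site 3) ![(r : ℤ), (r : ℤ), 0])) :
    ∃ c₁ : ℝ, 0 < c₁ ∧ ∃ r₀ : ℕ, ∀ r : ℕ, r₀ ≤ r →
      c₁ * tau 3 (criticalProbI 3) 0 ![(r : ℤ), (r : ℤ), 0] ≤
        (bondPercolation (zdGraph 3) (criticalProbI 3)).real
          (openConnIn {x : Site 3 | 2 * x 2 + 2 ≤ (r : ℤ)} (0 : Site 3) ![(r : ℤ), (r : ℤ), 0]) := by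
  sorry

/-- S9 (provable now): X_B and core restriction imply INTERFACE BLOCKING `stub_interfaceBlocking` (S13 of line
`SketchIdeator2`, verbatim conclusion) with `c₂ = c_X c²`: the decoupled event `{0 ↔_{Core} a_r} ∩ Shell ∩ {b_r ↔_{W} c_r}` lies in
`{0 ↔_{H_r} a_r} ∩ {b_r ↔_{U_r} c_r} ∩ {0 ↮ b_r}` (`Core_r ⊆ H_r`, `W_r ⊆ U_r`, shell ⇒ distinct clusters), and
`P(0 ↔_{H_r} a_r, b_r ↔_{U_r} c_r) ≤ τ(0,a_r)²` (pair symmetry). So the open pair (S4, S5) of this line is a SUFFICIENT condition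
for the open pair (S12, S13) of composition B of `SketchIdeator2`. -/
theorem stub_interfaceBlocking_of_shellRestriction
    (hXB : ∃ c : ℝ, 0 < c ∧ ∀ n : ℕ, 1 ≤ n →
      (bondPercolation (zdGraph 3) (criticalProbI 3)).real
          {ω | ∃ x ∈ box 3 n, ∃ y ∈ innerBoundary (zdGraph 3) (box 3 (2 * n)),
            ω ∈ openConnIn ↑(box 3 (2 * n)) x y} ≤ 1 - c)
    (hCore : ∃ c : ℝ, 0 < c ∧ ∃ r₀ : ℕ, ∀ r : ℕ, r₀ ≤ r →
      c * tau 3 (criticalProbI 3) 0 ![(r : ℤ), (r : ℤ), 0] ≤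
        (bondPercolation (zdGraph 3) (criticalProbI 3)).real
          (openConnIn
            {x : Site 3 | -((r : ℤ) / 8) ≤ x 0 ∧ x 0 ≤ (r : ℤ) + (r : ℤ) / 8 ∧
              -((r : ℤ) / 8) ≤ x 1 ∧ x 1 ≤ (r : ℤ) + (r : ℤ) / 8 ∧
              -((r : ℤ) + (r : ℤ) / 8) ≤ x 2 ∧ x 2 ≤ (r : ℤ) / 8}
            (0 : Site 3) ![(r : ℤ), (r : ℤ), 0])) :
    ∃ c₂ : ℝ, 0 < c₂ ∧ ∃ r₀ : ℕ, ∀ r : ℕ, r₀ ≤ r →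
      c₂ * (bondPercolation (zdGraph 3) (criticalProbI 3)).real
          (openConnIn {x : Site 3 | 2 * x 2 + 2 ≤ (r : ℤ)} (0 : Site 3) ![(r : ℤ), (r : ℤ), 0] ∩
            openConnIn {x : Site 3 | (r : ℤ) + 2 ≤ 2 * x 2} (![(r : ℤ), 0, (r : ℤ)] : Site 3) ![0, (r : ℤ), (r : ℤ)]) ≤
        (bondPercolation (zdGraph 3) (criticalProbI 3)).real
          (openConnIn {x : Site 3 | 2 * x 2 + 2 ≤ (r : ℤ)} (0 : Site 3) ![(r : ℤ), (r : ℤ), 0] ∩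
            openConnIn {x : Site 3 | (r : ℤ) + 2 ≤ 2 * x 2} (![(r : ℤ), 0, (r : ℤ)] : Site 3) ![0, (r : ℤ), (r : ℤ)] ∩
            (openConn (0 : Site 3) ![(r : ℤ), 0, (r : ℤ)])ᶜ) := by
  sorry

/-! ## S10 — off-path: the six walls of `B(2n) ∖ B(n)` bound the X_B crossing event (provable now; serves stmt-1151's last step) -/

/-- S10 (provable now, off-path). For `n ≥ 1` and every `p`: the X_B annulus-crossing event (some vertex of `B(n)` joined inside `B(2n)`
to the inner vertex boundary of `B(2n)`) forces an open crossing of the annulus `B(2n) ∖ B(n)` from a neighbour of `B(n)` to a vertex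
adjacent to `B(2n)ᶜ` (last exit from `B(n)`), i.e. it is disjoint from `Shell(B(n), B(2n))`; with S7 (`stub_shellOfSixWalls` at
`lo = −n`, `hi = n`, `lo' = −2n`, `hi' = 2n`): `P(X_B event) ≤ 1 − ∏_{6 walls} (1 − P(wall crossed in its thin direction))`, the walls being
the slabs `[−2n,2n]² × [n+1, 2n]` etc. (thickness `n`, lateral `4n+1`). This is the final step "an open path inside B(2n) from B(n) to
∂B(2n) crosses one of six slabs" of `PercAnnulusCrossing.BlockerRSWGlue` (stmt-CriticalPhenomena-1151), on whose crux X_B this line rests. -/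
theorem stub_annulusCrossing_le_walls (p : unitInterval) (n : ℕ) (hn : 1 ≤ n) :
    (bondPercolation (zdGraph 3) p).real
        {ω | ∃ x ∈ box 3 n, ∃ y ∈ innerBoundary (zdGraph 3) (box 3 (2 * n)),
          ω ∈ openConnIn ↑(box 3 (2 * n)) x y} ≤
      1 - ∏ i : Fin 3,
        ((1 - (bondPercolation (zdGraph 3) p).real
            {ω | ∃ x y : Site 3, x ∈ Set.Icc (fun _ : Fin 3 => -(2 * (n : ℤ))) (fun _ : Fin 3 => 2 * (n : ℤ)) ∧
              y ∈ Set.Icc (fun _ : Fin 3 => -(2 * (n : ℤ))) (fun _ : Fin 3 => 2 * (n : ℤ)) ∧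
              x i = (n : ℤ) + 1 ∧ y i = 2 * (n : ℤ) ∧
              ω ∈ openConnIn (Set.Icc (fun _ : Fin 3 => -(2 * (n : ℤ))) (fun _ : Fin 3 => 2 * (n : ℤ)) ∩
                {z | (n : ℤ) + 1 ≤ z i}) x y}) *
          (1 - (bondPercolation (zdGraph 3) p).real
            {ω | ∃ x y : Site 3, x ∈ Set.Icc (fun _ : Fin 3 => -(2 * (n : ℤ))) (fun _ : Fin 3 => 2 * (n : ℤ)) ∧
              y ∈ Set.Icc (fun _ : Fin 3 => -(2 * (n : ℤ))) (fun _ : Fin 3 => 2 * (n : ℤ)) ∧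
              x i = -(n : ℤ) - 1 ∧ y i = -(2 * (n : ℤ)) ∧
              ω ∈ openConnIn (Set.Icc (fun _ : Fin 3 => -(2 * (n : ℤ))) (fun _ : Fin 3 => 2 * (n : ℤ)) ∩
                {z | z i ≤ -(n : ℤ) - 1}) x y})) := by
  sorry

/-! ## Proved glue -/

/-- Complement of an X_B-type crossing event lies in the shell event: a crossing of `R' ∖ R` from a vertex `u`
adjacent to `R` (so `u ∈ I` by `hI`) to a vertex adjacent to `R'ᶜ` is in particular an open path inside `R'`. -/
theorem shell_superset_compl {V : Type*} (G : SimpleGraph V) {R R' I : Set V}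
    (hI : ∀ u, u ∉ R → (∃ z ∈ R, G.Adj u z) → u ∈ I) :
    {ω : BondConfig V | ∃ x ∈ I, ∃ y ∈ R', (∃ z ∉ R', G.Adj y z) ∧ ω ∈ openConnIn R' x y}ᶜ ⊆
      {ω | ∀ u ∈ R' \ R, ∀ w ∈ R' \ R, (∃ z ∈ R, G.Adj u z) → (∃ z ∉ R', G.Adj w z) →
        ω ∉ openConnIn (R' \ R) u w} := by
  intro ω hω u hu w hw huR hwR hconn
  apply hω
  exact ⟨u, hI u hu.2 huR, w, hw.1, hwR, openConnIn_mono (fun _ h => h.1) u w hconn⟩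

/-- Coordinates of lattice neighbours differ by at most one. -/
theorem adj_apply_sub_le {d : ℕ} {x y : Site d} (h : (zdGraph d).Adj x y) (j : Fin d) :
    y j - x j ≤ 1 ∧ x j - y j ≤ 1 := by
  obtain ⟨i, h | h⟩ := (zdGraph_adj_iff x y).1 h
  · rw [h]
    by_cases hj : j = i
    · subst hj; simp
    · simp [hj]
  · rw [h]
    by_cases hj : j = i
    · subst hj; simp
    · simp [hj]

/-! ## Composition (rev c2): the crux BY NAME, modulo S1, S3, S4, S5', T1 (tiled thin shell) -/

/-- The rev-c2 composition (closed TILED shell): X_B (S4) and box restriction (S5'), glued by the tiled shell (T1),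
the decoupling S1, the mirror S3 and the landed `stub_pairSymm`, give `TetrahedronDisjointCoexistence` with
`δ = c_X ^ (51³) · c²`. Objects (`k = ⌊r/8⌋ ≥ 8`, `s = ⌊r/16⌋ − 1`, mesh `g = 2s + 1`, margin `m = 2k − 1`):
`R = Box_r = [−r, 2r]² × [−2r, 3k]`, `R' = Box_r + B(m)` (roof `5k − 1`), `W = {r − 3k ≤ x₂}` (so `φ_r W = {x₂ ≤ 3k} ⊇ R`),
tiles centred at `anchor + g·j`, `j ∈ B(25)`, `anchor = (4k, 4k, −8k)`. -/
theorem TetrahedronDisjointCoexistence_of :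
    Theses.PercTreeValue.TetrahedronDisjointCoexistence := by
  unfold Theses.PercTreeValue.TetrahedronDisjointCoexistence
  obtain ⟨cX, hcX, hX⟩ := stub_annulusNonCrossing
  obtain ⟨c, hc, r₁, hC⟩ := stub_boxRestriction
  have hcX1 : cX ≤ 1 := by
    have h := hX 1 le_rfl
    have h0 : 0 ≤ (bondPercolation (zdGraph 3) (criticalProbI 3)).real
        {ω | ∃ x ∈ box 3 1, ∃ y ∈ innerBoundary (zdGraph 3) (box 3 (2 * 1)),
          ω ∈ openConnIn ↑(box 3 (2 * 1)) x y} := measureReal_nonneg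
    linarith
  refine ⟨cX ^ (51 ^ 3) * c ^ 2, by positivity, max r₁ 64, fun r hr => ?_⟩
  have hr₁ : r₁ ≤ r := le_trans (le_max_left _ _) hr
  have hr64 : 64 ≤ r := le_trans (le_max_right _ _) hr
  -- the objects
  set k : ℤ := (r : ℤ) / 8 with hk
  have hk8 : 8 ≤ k := by omega
  have hkr : 8 * k ≤ (r : ℤ) ∧ (r : ℤ) ≤ 8 * k + 7 := by omega
  set R : Set (Site 3) :=
    {x : Site 3 | -(r : ℤ) ≤ x 0 ∧ x 0 ≤ 2 * (r : ℤ) ∧ -(r : ℤ) ≤ x 1 ∧ x 1 ≤ 2 * (r : ℤ) ∧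
      -(2 * (r : ℤ)) ≤ x 2 ∧ x 2 ≤ 3 * ((r : ℤ) / 8)} with hR_def
  set R' : Set (Site 3) :=
    {x : Site 3 | -(r : ℤ) - (2 * k - 1) ≤ x 0 ∧ x 0 ≤ 2 * (r : ℤ) + (2 * k - 1) ∧
      -(r : ℤ) - (2 * k - 1) ≤ x 1 ∧ x 1 ≤ 2 * (r : ℤ) + (2 * k - 1) ∧
      -(2 * (r : ℤ)) - (2 * k - 1) ≤ x 2 ∧ x 2 ≤ 5 * k - 1} with hR'_def
  set W : Set (Site 3) := {x : Site 3 | (r : ℤ) - 3 * k ≤ x 2} with hW_def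
  set s : ℕ := r / 16 - 1 with hs
  have hs_cast : (s : ℤ) = (r : ℤ) / 16 - 1 := by omega
  have hsk : 2 * (s : ℤ) ≤ k - 2 ∧ k - 3 ≤ 2 * (s : ℤ) := by omega
  have hs1 : 1 ≤ s := by omega
  set g : ℤ := 2 * (s : ℤ) + 1 with hg
  have hgpos : 0 < g := by omega
  set anchor : Site 3 := ![4 * k, 4 * k, -(8 * k)] with hanchor
  have ha0 : anchor 0 = 4 * k := rfl
  have ha1 : anchor 1 = 4 * k := rfl
  have ha2 : anchor 2 = -(8 * k) := rfl
  set F : Site 3 → Site 3 := fun j i => anchor i + g * j i with hF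
  set J : Finset (Site 3) := (box 3 25).image F with hJ_def
  have hJcard : J.card ≤ 51 ^ 3 :=
    le_trans Finset.card_image_le (by rw [card_box])
  -- membership unfolding
  have mem_R : ∀ u : Site 3, u ∈ R ↔
      -(r : ℤ) ≤ u 0 ∧ u 0 ≤ 2 * (r : ℤ) ∧ -(r : ℤ) ≤ u 1 ∧ u 1 ≤ 2 * (r : ℤ) ∧
      -(2 * (r : ℤ)) ≤ u 2 ∧ u 2 ≤ 3 * ((r : ℤ) / 8) := fun u => Iff.rfl
  have mem_R' : ∀ u : Site 3, u ∈ R' ↔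
      -(r : ℤ) - (2 * k - 1) ≤ u 0 ∧ u 0 ≤ 2 * (r : ℤ) + (2 * k - 1) ∧
      -(r : ℤ) - (2 * k - 1) ≤ u 1 ∧ u 1 ≤ 2 * (r : ℤ) + (2 * k - 1) ∧
      -(2 * (r : ℤ)) - (2 * k - 1) ≤ u 2 ∧ u 2 ≤ 5 * k - 1 := fun u => Iff.rfl
  -- geometry
  have hRR' : R ⊆ R' := by
    intro u hu
    rw [mem_R] at hu
    rw [mem_R']
    omega
  have hN : ∀ x ∈ R, ∀ y, (zdGraph 3).Adj x y → y ∈ R' := by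
    intro x hx y hxy
    rw [mem_R] at hx
    rw [mem_R']
    have h0 := adj_apply_sub_le hxy 0
    have h1 := adj_apply_sub_le hxy 1
    have h2 := adj_apply_sub_le hxy 2
    omega
  have hWdisj : Disjoint R' W := by
    rw [Set.disjoint_left]
    intro u hu huW
    rw [mem_R'] at hu
    simp only [hW_def, Set.mem_setOf_eq] at huW
    omega
  have hRW : R ⊆ {x : Site 3 | x 2 ≤ (r : ℤ) - ((r : ℤ) - 3 * k)} := by
    intro u hu
    rw [mem_R] at hu
    simp only [Set.mem_setOf_eq]
    omega
  -- the cover: every vertex adjacent to `R` lies in a tile of the grid whose doubled tile (plus one layer) is inside `R'`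
  have hcover : ∀ u ∈ R' \ R, (∃ z ∈ R, (zdGraph 3).Adj u z) →
      ∃ v ∈ J, u - v ∈ box 3 s ∧
        ∀ y : Site 3, y - v ∈ box 3 (2 * s) → ∀ z : Site 3, (zdGraph 3).Adj y z → z ∈ R' := by
    rintro u - ⟨z₀, hz₀, huz₀⟩
    rw [mem_R] at hz₀
    have hb0 := adj_apply_sub_le huz₀ 0
    have hb1 := adj_apply_sub_le huz₀ 1
    have hb2 := adj_apply_sub_le huz₀ 2
    -- the tile index of `u`
    set q : Site 3 := fun i => (u i - anchor i + s) / g with hq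
    have hdiv : ∀ i, (u i - anchor i + s) % g + g * q i = u i - anchor i + s ∧
        0 ≤ (u i - anchor i + s) % g ∧ (u i - anchor i + s) % g < g := fun i =>
      ⟨Int.emod_add_mul_ediv _ _, Int.emod_nonneg _ hgpos.ne', Int.emod_lt_of_pos _ hgpos⟩
    -- a priori bounds on `u - anchor`
    have hlo : ∀ i, -(14 * k + 13) ≤ u i - anchor i ∧ u i - anchor i ≤ 14 * k + 13 := by
      intro i
      fin_cases i <;>
        simp only [ha0, ha1, ha2, Fin.zero_eta, Fin.mk_one, Fin.reduceFinMk, Fin.isValue] <;> omega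
    refine ⟨F q, ?_, ?_, ?_⟩
    · -- `F q ∈ J`
      rw [hJ_def, Finset.mem_image]
      refine ⟨q, ?_, rfl⟩
      rw [mem_box]
      intro i
      obtain ⟨he, h0, h1⟩ := hdiv i
      obtain ⟨hl, hu⟩ := hlo i
      constructor
      · by_contra hlt
        push Not at hlt
        have hm : g * q i ≤ g * (-26) := mul_le_mul_of_nonneg_left (by omega) hgpos.le
        generalize g * q i = X at he hm
        generalize (u i - anchor i + s) % g = Y at he h0 h1
        omega
      · by_contra hlt
        push Not at hlt
        have hm : g * 26 ≤ g * q i := mul_le_mul_of_nonneg_left (by omega) hgpos.le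
        generalize g * q i = X at he hm
        generalize (u i - anchor i + s) % g = Y at he h0 h1
        omega
    · -- `u - F q ∈ B(s)`
      rw [mem_box]
      intro i
      obtain ⟨he, h0, h1⟩ := hdiv i
      change -(s : ℤ) ≤ u i - (anchor i + g * q i) ∧ u i - (anchor i + g * q i) ≤ (s : ℤ)
      generalize g * q i = X at he ⊢
      generalize (u i - anchor i + s) % g = Y at he h0 h1
      omega
    · -- room: neighbours of `F q + B(2s)` lie in `R'`
      intro y hy z hyz
      rw [mem_box] at hy
      rw [mem_R']
      have hy0 := hy 0
      have hy1 := hy 1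
      have hy2 := hy 2
      change -((2 * s : ℕ) : ℤ) ≤ y 0 - (anchor 0 + g * q 0) ∧ y 0 - (anchor 0 + g * q 0) ≤ ((2 * s : ℕ) : ℤ)
        at hy0
      change -((2 * s : ℕ) : ℤ) ≤ y 1 - (anchor 1 + g * q 1) ∧ y 1 - (anchor 1 + g * q 1) ≤ ((2 * s : ℕ) : ℤ)
        at hy1
      change -((2 * s : ℕ) : ℤ) ≤ y 2 - (anchor 2 + g * q 2) ∧ y 2 - (anchor 2 + g * q 2) ≤ ((2 * s : ℕ) : ℤ)
        at hy2
      have hz0 := adj_apply_sub_le hyz 0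
      have hz1 := adj_apply_sub_le hyz 1
      have hz2 := adj_apply_sub_le hyz 2
      obtain ⟨he0, h00, h10⟩ := hdiv 0
      obtain ⟨he1, h01, h11⟩ := hdiv 1
      obtain ⟨he2, h02, h12⟩ := hdiv 2
      generalize g * q 0 = X0 at he0 hy0
      generalize g * q 1 = X1 at he1 hy1
      generalize g * q 2 = X2 at he2 hy2
      generalize (u 0 - anchor 0 + s) % g = Y0 at he0 h00 h10
      generalize (u 1 - anchor 1 + s) % g = Y1 at he1 h01 h11
      generalize (u 2 - anchor 2 + s) % g = Y2 at he2 h02 h12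
      push_cast at hy0 hy1 hy2
      omega
  -- T1: the tiled shell has probability ≥ cX ^ |J| ≥ cX ^ 51³
  have hT := stub_tiledShell (criticalProbI 3) s cX hcX.le (hX s hs1) R R' J hcover
  have hShell : cX ^ (51 ^ 3) ≤ (bondPercolation (zdGraph 3) (criticalProbI 3)).real
      {ω | ∀ u ∈ R' \ R, ∀ w ∈ R' \ R, (∃ z ∈ R, (zdGraph 3).Adj u z) →
        (∃ z ∉ R', (zdGraph 3).Adj w z) → ω ∉ openConnIn (R' \ R) u w} :=
    le_trans (pow_le_pow_of_le_one hcX.le hcX1 hJcard) hT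
  -- S1: decoupling
  have hdec := stub_shellDecoupling (zdGraph 3) (criticalProbI 3) hRR' hN hWdisj
    (0 : Site 3) ![(r : ℤ), (r : ℤ), 0] ![(r : ℤ), 0, (r : ℤ)] ![0, (r : ℤ), (r : ℤ)]
  -- S5' + S3: the two restricted connections
  have hA := hC r hr₁
  have hB : c * tau 3 (criticalProbI 3) 0 ![(r : ℤ), (r : ℤ), 0] ≤
      (bondPercolation (zdGraph 3) (criticalProbI 3)).real
        (openConnIn W (![(r : ℤ), 0, (r : ℤ)] : Site 3) ![0, (r : ℤ), (r : ℤ)]) := by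
    have hm := stub_mirrorRestrict (criticalProbI 3) r ((r : ℤ) - 3 * k)
    rw [hm]
    exact le_trans hA (measureReal_mono (openConnIn_mono hRW _ _))
  -- pair symmetry for τ
  obtain ⟨hτ, -⟩ := Theorems.TetrahedronDisjointCoexistence.stub_pairSymm (criticalProbI 3) r
  have hτ' : tau 3 (criticalProbI 3) ![(r : ℤ), 0, (r : ℤ)] ![0, (r : ℤ), (r : ℤ)] =
      tau 3 (criticalProbI 3) 0 ![(r : ℤ), (r : ℤ), 0] := by
    rw [tau_def, tau_def]; exact hτ
  rw [hτ']
  have hτnn : 0 ≤ tau 3 (criticalProbI 3) 0 ![(r : ℤ), (r : ℤ), 0] := tau_nonneg _ _ _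
  have hcτ : 0 ≤ c * tau 3 (criticalProbI 3) 0 ![(r : ℤ), (r : ℤ), 0] := by positivity
  have hcXN : 0 ≤ cX ^ (51 ^ 3) := by positivity
  calc cX ^ (51 ^ 3) * c ^ 2 * tau 3 (criticalProbI 3) 0 ![(r : ℤ), (r : ℤ), 0] *
        tau 3 (criticalProbI 3) 0 ![(r : ℤ), (r : ℤ), 0]
      = (c * tau 3 (criticalProbI 3) 0 ![(r : ℤ), (r : ℤ), 0]) * cX ^ (51 ^ 3) *
          (c * tau 3 (criticalProbI 3) 0 ![(r : ℤ), (r : ℤ), 0]) := by ring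
    _ ≤ (bondPercolation (zdGraph 3) (criticalProbI 3)).real
            (openConnIn R (0 : Site 3) ![(r : ℤ), (r : ℤ), 0]) *
          (bondPercolation (zdGraph 3) (criticalProbI 3)).real
            {ω | ∀ u ∈ R' \ R, ∀ w ∈ R' \ R, (∃ z ∈ R, (zdGraph 3).Adj u z) →
              (∃ z ∉ R', (zdGraph 3).Adj w z) → ω ∉ openConnIn (R' \ R) u w} *
          (bondPercolation (zdGraph 3) (criticalProbI 3)).real
            (openConnIn W (![(r : ℤ), 0, (r : ℤ)] : Site 3) ![0, (r : ℤ), (r : ℤ)]) := by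
        refine mul_le_mul (mul_le_mul hA hShell hcXN measureReal_nonneg) hB hcτ
          (mul_nonneg measureReal_nonneg measureReal_nonneg)
    _ ≤ _ := hdec

end Summit.CriticalPhenomena.PercolationContinuityZ3.Cruxes.TetrahedronDisjointCoexistence.LineSketch

end
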